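import Mathlib
import HarnessLib
import Literature.MathematicalPhysics.StatisticalMechanics.LennardJonesClusters
import Literature.MathematicalPhysics.StatisticalMechanics.LennardJonesThermodynamicLimitProofs
import Summits.AtomisticToContinuum.Crystallization.Theorems.LoopTunnelDialLocalSurgery
import Summits.AtomisticToContinuum.Crystallization.Theorems.LoopTunnelDialOrderOneRung
import Summits.AtomisticToContinuum.Crystallization.Theorems.LoopTunnelDialVoidRung

/-!
# LoopTunnelDial — CREDITED VOIDS: the order-`k` rung of `PocketCase` (stmt-AtomisticToContinuum-27294) retuned to the crystal's own
spacing, with an abstract credit and certified tier windows reaching the first FOUR shells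

decomp-a2c lens-5, generation 23, part 2 (`--supports stmt-AtomisticToContinuum-27294 --as helper`; lands AFTER `LoopTunnelDialVoidRung`).
Sorry-free, NO definitions, GS-free, certified constants only.

WHY (an ERRATUM ON A READING, not on a theorem).  The landed order-one window `[39/40, 103/100]` (`LoopTunnelDialLocalSurgery` §6,
`LoopTunnelDialOrderOneRung`, and `LoopTunnelDialVoidRung` §1–§5) is centred on the PAIR minimum `r₀ = 1` of `V_LJ`; but the Lennard-Jones
crystal's own nearest-neighbour spacing is `a⋆ = (S₁₂/S₆)^{1/6} = 0.9713` (fcc lattice sums; the value used by the census, TAG 118) — BELOW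
`39/40 = 0.975`.  At the crystal's spacing the twelve cage neighbours of a vacancy sit at `≈ 0.971` (relaxed: `≈ 0.968`, inward) from the empty
site, OUTSIDE that window: the vacancy-centred hole has `P = 0` window contacts and no `9/10`-clear point near it has more than a handful — the
order-one certificate `P ≥ 10` and the `[39/40, 103/100]`-counted void certificate are TRUE THEOREMS THAT DO NOT FIRE on the relaxed crystal's
vacancies.  The docstring readings «relaxed vacancies (12), divacancy sites (11), trivacancy sites (10) are absent» must be read at spacing `1`,
not at `a⋆`.  This file repairs the reach, not the logic:

§7 ABSTRACT CREDIT.  For ANY `w : ℝ → ℝ` with `V_LJ(t) ≤ −w(t)` for all `t ≥ 9/10` («a certified credit»): over `9/10`-clear index sets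
   `Σ V ≤ −Σ w`; a `9/10`-separated, `9/10`-clear hole family `q : Fin k → E3` (`k ≤ ⌈64R³⌉`, each hole within `R` of `y c`) with
   `2·(B·k + η) ≤ 2·P_w + D_w`, `P_w := Σ_i Σ_m w(|q_i − y_m|)`, `D_w := Σ_i Σ_{l ≠ i} w(|q_i − q_l|)`, `B := 0.78647722` (the landed two-cone
   level floor), is a radius-`R` IMPROVEMENT by `η` at every level `e ≥ −B` (`improvable_of_creditedVoid`); conversely an `(e, ε, j)`-μ-stable
   injective configuration (`j ≥ ⌈64R³⌉`, `e ≥ −B`) has EVERY such family credited by at most `2·(B·k + ε)` (`credit_le_of_muStable`); sequence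
   forms `credit_void_floor` (the line's `FloorEvI` shape, margin `1/100`, radius `1` on) and `rigid_credit_void_seat` (the line's `RigidNearPocket0`
   on the credited-void class, at every order `j₀ ≥ ⌈64R³⌉`, at every index).
§8 CERTIFIED TIERS.  One parametric pair bound `lennardJones_le_of_mem_window` (`V_LJ + c = ((u−1)² − (1−12c))/12`, `u = r⁻⁶`) and five
   instances:  `[23/25, 239/250] ↦ 1/21` · `[239/250, 53/50] ↦ 3/40` · `[53/50, 36/25] ↦ 1/60` · `[36/25, 7/4] ↦ 1/200` · `[7/4, 21/10] ↦ 1/600`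
   — contiguous from `0.92` to `2.1`, so at ANY spacing `a ∈ [0.956, 1.01]` the first shell (12 at `a`), second (6 at `√2·a`), third (24 at `√3·a`)
   and fourth (12 at `2a`) are all credited: a bulk site is credited `12·(3/40) + 6·(1/60) + 24·(1/200) + 12·(1/600) = 1.14` (true binding `2|e⋆| ≈
   1.435`); the five-tier step credit `lennardJones_le_neg_tierCredit`.
§9 THE REPAIRED ORDER-ONE CERTIFICATE.  `improvable_of_wideCagedHole`: ONE `9/10`-clear point within `R ≥ 1` of `y c` with `≥ 11` particles at
   distance in `[239/250, 53/50)` (`= [0.956, 1.06)`, containing `a⋆ ± 1.2 %`) is a radius-`R` improvement by `η ≤ 1/100` at every `e ≥ −B`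
   (`11·(3/40) = 0.825 ≥ B + 1/100`): relaxed vacancies (12) and divacancy sites (11) ARE excluded at the crystal's spacing; its μ-reading
   `wideCagedCount_le_of_muStable` (`≤ 10` such neighbours at μ-order `≥ max ⌈64R³⌉ 100`).

CERTIFIED REACH OF THE TIERED CERTIFICATE (exact tier arithmetic on the fcc environment at spacing `a⋆ = 0.9713`, lens-5 g23 folder
`num/reach.py`; stated as the test it is): writing `β = 1.14` for the credited binding of a bulk site and `δ̄ := D_w/k` for the holes' mean credited
INTERNAL binding, a void (any sub-family of the empty sites may serve as `q`) is certified iff `δ̄ ≤ 2·(β − B) − 2η/k = 0.707 − 0.02/k`: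
vacancy (`2P_w = 2.28 ≥ 1.59`), divacancy, trivacancy, tetra-vacancy, octahedral 6-void (`11.78 ≥ 9.46`), the 13-site cuboctahedral void
(`23.58 ≥ 20.47`), the 19-void, compact voids up to the 55-ball (`86.98 ≥ 86.53`) and the 63-cube (`100.5 ≥ 99.1`), vacancy rows, 3×3 tubes,
(111) single-layer vacancy discs of EVERY size (interior `δ = 0.49`), two-layer discs up to about 200 sites (`k = 211`: `332.2 ≥ 331.9`);
NOT the 87-ball (`133.3 < 136.9`), three-layer discs from about 100 sites, unbounded two-layer slabs (interior `δ = 0.795`) — thick sealed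
cavities of roughly 100 vacancies and more (cavity price = crystalline surface energy with tails to all orders) remain the located asymptotic
residual of the NEAR world; the window certificate of `LoopTunnelDialVoidRung` reached mean internal coordination `≤ 4` at spacing `1` only.
-/

open scoped BigOperators Classical Topology
open Filter
open Literature.MathematicalPhysics.StatisticalMechanics
open Summit.AtomisticToContinuum.Crystallization.Theorems.GrainPercolationDialCrossCeiling (E3)
open Summit.AtomisticToContinuum.Crystallization.Theorems.LoopTunnelDialLocalSurgery
open Summit.AtomisticToContinuum.Crystallization.Theorems.LoopTunnelDialVoidRung

namespace Summit.AtomisticToContinuum.Crystallization.Theorems.LoopTunnelDialVoidRungCredit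

variable {N : ℕ}

/-! ## §7 Abstract credit -/

/-- Over a `9/10`-clear index set, `Σ V ≤ −Σ w` for any certified credit `w`. -/
theorem sum_lennardJones_le_neg_sum_credit {ι : Type*} (S : Finset ι) (r : ι → ℝ) (w : ℝ → ℝ)
    (hw : ∀ t : ℝ, 9 / 10 ≤ t → lennardJones t ≤ -w t) (hclear : ∀ l ∈ S, 9 / 10 ≤ r l) :
    ∑ l ∈ S, lennardJones (r l) ≤ -∑ l ∈ S, w (r l) := by
  rw [← Finset.sum_neg_distrib]
  exact Finset.sum_le_sum fun l hl => hw _ (hclear l hl)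

/-- Self-energy of a `9/10`-separated hole family: `2·𝓔(q) ≤ −D_w`. -/
theorem two_mul_interactionEnergy_le_neg_credit {k : ℕ} (q : Fin k → E3) (w : ℝ → ℝ)
    (hw : ∀ t : ℝ, 9 / 10 ≤ t → lennardJones t ≤ -w t) (hsep : ∀ i l : Fin k, i ≠ l → 9 / 10 ≤ dist (q i) (q l)) :
    2 * interactionEnergy lennardJones q ≤ -∑ i : Fin k, ∑ l ∈ Finset.univ.erase i, w (dist (q i) (q l)) := by
  rw [two_mul_interactionEnergy lennardJones q, ← Finset.sum_neg_distrib]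
  refine Finset.sum_le_sum fun i _ => ?_
  unfold siteEnergy
  exact sum_lennardJones_le_neg_sum_credit (Finset.univ.erase i) (fun l => dist (q i) (q l)) w hw
    fun l hl => hsep i l (Ne.symm (Finset.mem_erase.1 hl).1)

/-- Cross terms of `9/10`-clear holes: `Σ_i Σ_m V(|q_i − y_m|) ≤ −P_w`. -/
theorem cross_le_neg_credit {k : ℕ} (q : Fin k → E3) (y : Fin N → E3) (w : ℝ → ℝ)
    (hw : ∀ t : ℝ, 9 / 10 ≤ t → lennardJones t ≤ -w t) (hclear : ∀ (i : Fin k) (m : Fin N), 9 / 10 ≤ dist (q i) (y m)) :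
    ∑ i : Fin k, ∑ m : Fin N, lennardJones (dist (q i) (y m)) ≤ -∑ i : Fin k, ∑ m : Fin N, w (dist (q i) (y m)) := by
  rw [← Finset.sum_neg_distrib]
  exact Finset.sum_le_sum fun i _ =>
    sum_lennardJones_le_neg_sum_credit Finset.univ (fun m => dist (q i) (y m)) w hw fun m _ => hclear i m

/-- **A CREDITED VOID is a radius-`R` improvement (PROVED, GS-free, any certified credit `w`):** holes `q : Fin k → E3`, `k ≤ ⌈64R³⌉`, each
within `R` of `y c`, `9/10`-clear, pairwise `9/10`-separated, with `2·(B·k + η) ≤ 2·P_w + D_w`; then at every level `e ≥ −B = −0.78647722`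
filling the void (`Fin.append q y`) is an improvement by `η` in the landed local-surgery currency about `y c`. -/
theorem improvable_of_creditedVoid {y : Fin N → E3} (hy : Function.Injective y) {R : ℝ} {c : Fin N}
    {k : ℕ} {q : Fin k → E3} (hkR : k ≤ ⌈64 * R ^ 3⌉₊)
    (hqc : ∀ i : Fin k, dist (q i) (y c) ≤ R) (hclear : ∀ (i : Fin k) (m : Fin N), 9 / 10 ≤ dist (q i) (y m))
    (hsep : ∀ i l : Fin k, i ≠ l → 9 / 10 ≤ dist (q i) (q l))
    (w : ℝ → ℝ) (hw : ∀ t : ℝ, 9 / 10 ≤ t → lennardJones t ≤ -w t)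
    {e η : ℝ} (he : -(98309653 / 125000000 : ℝ) ≤ e)
    (hcount : 2 * ((98309653 / 125000000 : ℝ) * k + η) ≤
      2 * ∑ i : Fin k, ∑ m : Fin N, w (dist (q i) (y m)) + ∑ i : Fin k, ∑ l ∈ Finset.univ.erase i, w (dist (q i) (q l))) :
    ∃ (M : ℕ) (z : Fin M → E3), Function.Injective z ∧
      (∀ m : Fin N, R < dist (y m) (y c) → y m ∈ Set.range z) ∧
      (∀ l : Fin M, R < dist (z l) (y c) → z l ∈ Set.range y) ∧
      N ≤ M + ⌈64 * R ^ 3⌉₊ ∧ M ≤ N + ⌈64 * R ^ 3⌉₊ ∧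
      interactionEnergy lennardJones z + η ≤ interactionEnergy lennardJones y + e * ((M : ℝ) - N) := by
  have hqinj : Function.Injective q := by
    intro i l h
    by_contra hil
    have h' := hsep i l hil
    rw [h, dist_self] at h'
    norm_num at h'
  have hdisj : ∀ (i : Fin k) (m : Fin N), q i ≠ y m := by
    intro i m h
    have h' := hclear i m
    rw [h, dist_self] at h'
    norm_num at h'
  have hinj : Function.Injective (Fin.append q y) := Fin.append_injective_iff.2 ⟨hqinj, hy, hdisj⟩
  refine ⟨k + N, Fin.append q y, hinj, fun m _ => ⟨Fin.natAdd k m, Fin.append_right q y m⟩, fun l hl => ?_,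
    by omega, by omega, ?_⟩
  · revert hl
    refine Fin.addCases (motive := fun l => R < dist (Fin.append q y l) (y c) → Fin.append q y l ∈ Set.range y)
      (fun i hi => ?_) (fun m _ => ?_) l
    · rw [Fin.append_left] at hi
      exact absurd (hqc i) (not_le.2 hi)
    · exact ⟨m, (Fin.append_right q y m).symm⟩
  · have hE := interactionEnergy_append lennardJones lennardJones_zero q y
    have hself := two_mul_interactionEnergy_le_neg_credit q w hw hsep
    have hcross := cross_le_neg_credit q y w hw hclear
    have hcast : e * (((k + N : ℕ) : ℝ) - (N : ℝ)) = e * k := by push_cast; ring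
    rw [hcast]
    have hk0 : (0 : ℝ) ≤ k := Nat.cast_nonneg k
    have hek : -(98309653 / 125000000 : ℝ) * k ≤ e * k := mul_le_mul_of_nonneg_right he hk0
    linarith

/-- **HOLE FAMILIES OF A μ-STABLE CONFIGURATION ARE UNDER-CREDITED (PROVED, GS-free):** an `(e, ε, j)`-μ-stable injective configuration with
`⌈64R³⌉ ≤ j` and `e ≥ −B` has every `9/10`-clear, `9/10`-separated hole family `q : Fin k → E3` (`k ≤ ⌈64R³⌉`) within `R` of a particle
credited by at most `2·(B·k + ε)`, for every certified credit `w`. -/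
theorem credit_le_of_muStable {e ε : ℝ} (he : -(98309653 / 125000000 : ℝ) ≤ e) {R : ℝ} {j : ℕ} (hjR : ⌈64 * R ^ 3⌉₊ ≤ j)
    {y : Fin N → E3} (hy : Function.Injective y)
    (hM : ∀ M : ℕ, N ≤ M + j → M ≤ N + j → ∀ z : Fin M → E3, Function.Injective z →
      interactionEnergy lennardJones y + e * ((M : ℝ) - N) - ε ≤ interactionEnergy lennardJones z)
    (c : Fin N) {k : ℕ} {q : Fin k → E3} (hkR : k ≤ ⌈64 * R ^ 3⌉₊)
    (hqc : ∀ i : Fin k, dist (q i) (y c) ≤ R) (hclear : ∀ (i : Fin k) (m : Fin N), 9 / 10 ≤ dist (q i) (y m))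
    (hsep : ∀ i l : Fin k, i ≠ l → 9 / 10 ≤ dist (q i) (q l))
    (w : ℝ → ℝ) (hw : ∀ t : ℝ, 9 / 10 ≤ t → lennardJones t ≤ -w t) :
    2 * ∑ i : Fin k, ∑ m : Fin N, w (dist (q i) (y m)) + ∑ i : Fin k, ∑ l ∈ Finset.univ.erase i, w (dist (q i) (q l)) ≤
      2 * ((98309653 / 125000000 : ℝ) * k + ε) := by
  by_contra hnot
  have hlt := not_le.1 hnot
  have hεη : ε < (2 * ∑ i : Fin k, ∑ m : Fin N, w (dist (q i) (y m)) +
      ∑ i : Fin k, ∑ l ∈ Finset.univ.erase i, w (dist (q i) (q l))) / 2 - (98309653 / 125000000 : ℝ) * k := by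
    linarith
  exact not_improvable_of_muStable hM hjR hεη c
    (improvable_of_creditedVoid hy hkR hqc hclear hsep w hw he (by linarith))

/-- **CREDITED-VOID RUNG (PROVED, GS-free, any certified credit):** the line's `FloorEvI x trig` unfolded, for the trigger «some `9/10`-clear,
`9/10`-separated hole family within `R` of a particle is credited `≥ 2·(B·k + 1/100)`», margin `1/100`, from radius `1` on, at every index. -/
theorem credit_void_floor (w : ℝ → ℝ) (hw : ∀ t : ℝ, 9 / 10 ≤ t → lennardJones t ≤ -w t)
    (x : (N : ℕ) → (Fin N → E3)) (hx : ∀ N, Function.Injective (x N)) :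
    ∃ η R₁ : ℝ, 0 < η ∧ ∀ e : ℝ, Tendsto (fun N : ℕ => groundStateEnergy lennardJones 3 N / N) atTop (𝓝 e) →
      ∀ R : ℝ, R₁ ≤ R → ∀ᶠ N in atTop,
        (∃ (c : Fin N) (k : ℕ) (q : Fin k → E3), (∀ i : Fin k, dist (q i) (x N c) ≤ R) ∧
          (∀ (i : Fin k) (m : Fin N), 9 / 10 ≤ dist (q i) (x N m)) ∧ (∀ i l : Fin k, i ≠ l → 9 / 10 ≤ dist (q i) (q l)) ∧
          2 * ((98309653 / 125000000 : ℝ) * k + 1 / 100) ≤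
            2 * ∑ i : Fin k, ∑ m : Fin N, w (dist (q i) (x N m)) + ∑ i : Fin k, ∑ l ∈ Finset.univ.erase i, w (dist (q i) (q l))) →
        ∃ (c : Fin N) (M : ℕ) (z : Fin M → E3), Function.Injective z ∧
          (∀ m : Fin N, R < dist (x N m) (x N c) → x N m ∈ Set.range z) ∧
          (∀ l : Fin M, R < dist (z l) (x N c) → z l ∈ Set.range (x N)) ∧
          N ≤ M + ⌈64 * R ^ 3⌉₊ ∧ M ≤ N + ⌈64 * R ^ 3⌉₊ ∧
          interactionEnergy lennardJones z + 1 / 100 ≤ interactionEnergy lennardJones (x N) + e * ((M : ℝ) - N) := by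
  refine ⟨1 / 100, 1, by norm_num, fun e he R hR => Filter.Eventually.of_forall fun N hdef => ?_⟩
  obtain ⟨c, k, q, hqc, hclear, hsep, hcount⟩ := hdef
  exact ⟨c, improvable_of_creditedVoid (hx N) (holes_card_le hR hqc hsep) hqc hclear hsep w hw (twoConeB_le_of_tendsto he) hcount⟩

/-- **μ-SEAT OF THE CREDITED-VOID RUNG (PROVED, GS-free) — the line's `RigidNearPocket0` on the credited-void class, at EVERY order
`j₀ ≥ ⌈64R³⌉`, every radius `R ≥ 1`, every index:** an `(e, 1/(j₀+1), j₀)`-μ-stable `x N` has every hole family within `R` of a particle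
credited `≤ 2·(B·k + 1/(j₀+1))`. -/
theorem rigid_credit_void_seat (w : ℝ → ℝ) (hw : ∀ t : ℝ, 9 / 10 ≤ t → lennardJones t ≤ -w t)
    (x : (N : ℕ) → (Fin N → E3)) (hx : ∀ N, Function.Injective (x N)) :
    ∀ R : ℝ, 1 ≤ R → ∀ e : ℝ, Tendsto (fun N : ℕ => groundStateEnergy lennardJones 3 N / N) atTop (𝓝 e) →
      ∀ j₀ : ℕ, ⌈64 * R ^ 3⌉₊ ≤ j₀ → ∀ N : ℕ,
        (∀ M : ℕ, N ≤ M + j₀ → M ≤ N + j₀ → ∀ z : Fin M → E3, Function.Injective z →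
          interactionEnergy lennardJones (x N) + e * ((M : ℝ) - N) - 1 / ((j₀ : ℝ) + 1) ≤ interactionEnergy lennardJones z) →
        ∀ (c : Fin N) (k : ℕ) (q : Fin k → E3), (∀ i : Fin k, dist (q i) (x N c) ≤ R) →
          (∀ (i : Fin k) (m : Fin N), 9 / 10 ≤ dist (q i) (x N m)) → (∀ i l : Fin k, i ≠ l → 9 / 10 ≤ dist (q i) (q l)) →
          2 * ∑ i : Fin k, ∑ m : Fin N, w (dist (q i) (x N m)) + ∑ i : Fin k, ∑ l ∈ Finset.univ.erase i, w (dist (q i) (q l)) ≤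
            2 * ((98309653 / 125000000 : ℝ) * k + 1 / ((j₀ : ℝ) + 1)) := by
  intro R hR e he j₀ hj₀ N hM c k q hqc hclear hsep
  exact credit_le_of_muStable (twoConeB_le_of_tendsto he) hj₀ (hx N) hM c (holes_card_le hR hqc hsep) hqc hclear hsep w hw

/-! ## §8 Certified tiers -/

/-- **Parametric pair bound:** on `[a, b]` (`0 < a`), if `s² ≤ 1 − 12c`, `1 − s ≤ b⁻⁶` and `a⁻⁶ ≤ 1 + s`, then `V_LJ ≤ −c`
(`12·(V_LJ(r) + c) = (u − 1)² − (1 − 12c)` with `u = r⁻⁶ ∈ [b⁻⁶, a⁻⁶] ⊆ [1 − s, 1 + s]`). -/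
theorem lennardJones_le_of_mem_window {a b c s r : ℝ} (ha : 0 < a) (har : a ≤ r) (hrb : r ≤ b)
    (hs : s ^ 2 ≤ 1 - 12 * c) (hlo : 1 - s ≤ (b⁻¹) ^ 6) (hhi : (a⁻¹) ^ 6 ≤ 1 + s) : lennardJones r ≤ -c := by
  unfold lennardJones
  have h0 : 0 < r := lt_of_lt_of_le ha har
  have hb : 0 < b := lt_of_lt_of_le h0 hrb
  have h1 : r⁻¹ ≤ a⁻¹ := inv_anti₀ ha har
  have h2 : b⁻¹ ≤ r⁻¹ := inv_anti₀ h0 hrb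
  have hr0 : 0 ≤ r⁻¹ := inv_nonneg.2 h0.le
  have hb0 : 0 ≤ b⁻¹ := inv_nonneg.2 hb.le
  have hu1 : (r⁻¹) ^ 6 ≤ (a⁻¹) ^ 6 := pow_le_pow_left₀ hr0 h1 6
  have hu2 : (b⁻¹) ^ 6 ≤ (r⁻¹) ^ 6 := pow_le_pow_left₀ hb0 h2 6
  have h12 : (r⁻¹) ^ 12 = ((r⁻¹) ^ 6) ^ 2 := by ring
  rw [h12]
  have hsq : ((r⁻¹) ^ 6 - 1) ^ 2 ≤ s ^ 2 := by
    apply sq_le_sq'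
    · linarith
    · linarith
  nlinarith

/-- Tier 0: `V_LJ ≤ −1/21` on `[23/25, 239/250]`. -/
theorem lennardJones_le_tier0 {r : ℝ} (h1 : 23 / 25 ≤ r) (h2 : r ≤ 239 / 250) : lennardJones r ≤ -(1 / 21) :=
  lennardJones_le_of_mem_window (a := 23 / 25) (b := 239 / 250) (s := 13 / 20) (by norm_num) h1 h2
    (by norm_num) (by norm_num) (by norm_num)

/-- Tier 1: `V_LJ ≤ −3/40` on `[239/250, 53/50]` (`= [0.956, 1.06]`, containing the crystal's spacing `a⋆ = 0.9713` `± 1.2 %`). -/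
theorem lennardJones_le_tier1 {r : ℝ} (h1 : 239 / 250 ≤ r) (h2 : r ≤ 53 / 50) : lennardJones r ≤ -(3 / 40) :=
  lennardJones_le_of_mem_window (a := 239 / 250) (b := 53 / 50) (s := 31 / 100) (by norm_num) h1 h2
    (by norm_num) (by norm_num) (by norm_num)

/-- Tier 2: `V_LJ ≤ −1/60` on `[53/50, 36/25]` (second shell `√2·a⋆ = 1.374`). -/
theorem lennardJones_le_tier2 {r : ℝ} (h1 : 53 / 50 ≤ r) (h2 : r ≤ 36 / 25) : lennardJones r ≤ -(1 / 60) :=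
  lennardJones_le_of_mem_window (a := 53 / 50) (b := 36 / 25) (s := 89 / 100) (by norm_num) h1 h2
    (by norm_num) (by norm_num) (by norm_num)

/-- Tier 3: `V_LJ ≤ −1/200` on `[36/25, 7/4]` (third shell `√3·a⋆ = 1.682`). -/
theorem lennardJones_le_tier3 {r : ℝ} (h1 : 36 / 25 ≤ r) (h2 : r ≤ 7 / 4) : lennardJones r ≤ -(1 / 200) :=
  lennardJones_le_of_mem_window (a := 36 / 25) (b := 7 / 4) (s := 967 / 1000) (by norm_num) h1 h2
    (by norm_num) (by norm_num) (by norm_num)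

/-- Tier 4: `V_LJ ≤ −1/600` on `[7/4, 21/10]` (fourth shell `2·a⋆ = 1.943`). -/
theorem lennardJones_le_tier4 {r : ℝ} (h1 : 7 / 4 ≤ r) (h2 : r ≤ 21 / 10) : lennardJones r ≤ -(1 / 600) :=
  lennardJones_le_of_mem_window (a := 7 / 4) (b := 21 / 10) (s := 989 / 1000) (by norm_num) h1 h2
    (by norm_num) (by norm_num) (by norm_num)

/-- **The five-tier step credit is certified (PROVED):** for `t ≥ 9/10`,
`V_LJ(t) ≤ −(1/21·𝟙[23/25, 239/250) + 3/40·𝟙[239/250, 53/50) + 1/60·𝟙[53/50, 36/25) + 1/200·𝟙[36/25, 7/4) + 1/600·𝟙[7/4, 21/10))(t)`. -/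
theorem lennardJones_le_neg_tierCredit {t : ℝ} (ht : 9 / 10 ≤ t) :
    lennardJones t ≤ -((1 / 21) * (if 23 / 25 ≤ t ∧ t < 239 / 250 then 1 else 0) +
      (3 / 40) * (if 239 / 250 ≤ t ∧ t < 53 / 50 then 1 else 0) +
      (1 / 60) * (if 53 / 50 ≤ t ∧ t < 36 / 25 then 1 else 0) +
      (1 / 200) * (if 36 / 25 ≤ t ∧ t < 7 / 4 then 1 else 0) +
      (1 / 600) * (if 7 / 4 ≤ t ∧ t < 21 / 10 then 1 else 0)) := by
  have lennardJones_nonpos_of_ge : ∀ {r : ℝ}, 9 / 10 ≤ r → lennardJones r ≤ 0 := by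
    intro r hr
    unfold lennardJones
    have h0 : 0 < r := by linarith
    have hinv : r⁻¹ ≤ (9 / 10 : ℝ)⁻¹ := inv_anti₀ (by norm_num) hr
    have hinv0 : 0 ≤ r⁻¹ := inv_nonneg.2 h0.le
    have ht : (r⁻¹) ^ 6 ≤ ((9 / 10 : ℝ)⁻¹) ^ 6 := pow_le_pow_left₀ hinv0 hinv 6
    have h2 : ((9 / 10 : ℝ)⁻¹) ^ 6 < 2 := by norm_num
    have h12 : (r⁻¹) ^ 12 = ((r⁻¹) ^ 6) ^ 2 := by ring
    rw [h12]
    nlinarith [pow_nonneg hinv0 6]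
  have hV0 := lennardJones_nonpos_of_ge ht
  by_cases h0 : 23 / 25 ≤ t ∧ t < 239 / 250
  · have hV := lennardJones_le_tier0 h0.1 h0.2.le
    have n1 : ¬ (239 / 250 ≤ t ∧ t < 53 / 50) := fun h => by linarith [h.1, h0.2]
    have n2 : ¬ (53 / 50 ≤ t ∧ t < 36 / 25) := fun h => by linarith [h.1, h0.2]
    have n3 : ¬ (36 / 25 ≤ t ∧ t < 7 / 4) := fun h => by linarith [h.1, h0.2]
    have n4 : ¬ (7 / 4 ≤ t ∧ t < 21 / 10) := fun h => by linarith [h.1, h0.2]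
    rw [if_pos h0, if_neg n1, if_neg n2, if_neg n3, if_neg n4]
    linarith
  by_cases h1 : 239 / 250 ≤ t ∧ t < 53 / 50
  · have hV := lennardJones_le_tier1 h1.1 h1.2.le
    have n2 : ¬ (53 / 50 ≤ t ∧ t < 36 / 25) := fun h => by linarith [h.1, h1.2]
    have n3 : ¬ (36 / 25 ≤ t ∧ t < 7 / 4) := fun h => by linarith [h.1, h1.2]
    have n4 : ¬ (7 / 4 ≤ t ∧ t < 21 / 10) := fun h => by linarith [h.1, h1.2]
    rw [if_neg h0, if_pos h1, if_neg n2, if_neg n3, if_neg n4]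
    linarith
  by_cases h2 : 53 / 50 ≤ t ∧ t < 36 / 25
  · have hV := lennardJones_le_tier2 h2.1 h2.2.le
    have n3 : ¬ (36 / 25 ≤ t ∧ t < 7 / 4) := fun h => by linarith [h.1, h2.2]
    have n4 : ¬ (7 / 4 ≤ t ∧ t < 21 / 10) := fun h => by linarith [h.1, h2.2]
    rw [if_neg h0, if_neg h1, if_pos h2, if_neg n3, if_neg n4]
    linarith
  by_cases h3 : 36 / 25 ≤ t ∧ t < 7 / 4
  · have hV := lennardJones_le_tier3 h3.1 h3.2.le
    have n4 : ¬ (7 / 4 ≤ t ∧ t < 21 / 10) := fun h => by linarith [h.1, h3.2]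
    rw [if_neg h0, if_neg h1, if_neg h2, if_pos h3, if_neg n4]
    linarith
  by_cases h4 : 7 / 4 ≤ t ∧ t < 21 / 10
  · have hV := lennardJones_le_tier4 h4.1 h4.2.le
    rw [if_neg h0, if_neg h1, if_neg h2, if_neg h3, if_pos h4]
    linarith
  · rw [if_neg h0, if_neg h1, if_neg h2, if_neg h3, if_neg h4]
    linarith

/-! ## §9 The repaired order-one certificate: wide cages at the crystal's own spacing -/

/-- The single-window credit `3/40·𝟙[239/250, 53/50)` is certified. -/
theorem lennardJones_le_neg_wideCredit {t : ℝ} (ht : 9 / 10 ≤ t) :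
    lennardJones t ≤ -((3 / 40) * (if 239 / 250 ≤ t ∧ t < 53 / 50 then 1 else 0)) := by
  have lennardJones_nonpos_of_ge : ∀ {r : ℝ}, 9 / 10 ≤ r → lennardJones r ≤ 0 := by
    intro r hr
    unfold lennardJones
    have h0 : 0 < r := by linarith
    have hinv : r⁻¹ ≤ (9 / 10 : ℝ)⁻¹ := inv_anti₀ (by norm_num) hr
    have hinv0 : 0 ≤ r⁻¹ := inv_nonneg.2 h0.le
    have ht : (r⁻¹) ^ 6 ≤ ((9 / 10 : ℝ)⁻¹) ^ 6 := pow_le_pow_left₀ hinv0 hinv 6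
    have h2 : ((9 / 10 : ℝ)⁻¹) ^ 6 < 2 := by norm_num
    have h12 : (r⁻¹) ^ 12 = ((r⁻¹) ^ 6) ^ 2 := by ring
    rw [h12]
    nlinarith [pow_nonneg hinv0 6]
  by_cases h : 239 / 250 ≤ t ∧ t < 53 / 50
  · rw [if_pos h]
    linarith [lennardJones_le_tier1 h.1 h.2.le]
  · rw [if_neg h]
    linarith [lennardJones_nonpos_of_ge ht]

/-- **WIDE-CAGED HOLES are radius-`R` improvements (PROVED, GS-free) — the order-one certificate at the crystal's spacing:** a `9/10`-clear
point `p` within `R ≥ 1` of `y c` with at least `11` particles at distance in `[239/250, 53/50)` is, at every level `e ≥ −0.78647722` and margin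
`η ≤ 1/100`, fillable with gain (`11·(3/40) = 0.825 ≥ 0.7865 + 0.01`): relaxed vacancies (12 cage neighbours at `≈ 0.968`) and divacancy sites
(11) qualify. -/
theorem improvable_of_wideCagedHole {y : Fin N → E3} (hy : Function.Injective y) {R : ℝ} (hR : 1 ≤ R) {c : Fin N} {p : E3}
    (hpc : dist p (y c) ≤ R) (hclear : ∀ m : Fin N, 9 / 10 ≤ dist p (y m))
    (hcaged : 11 ≤ (Finset.univ.filter fun m : Fin N => 239 / 250 ≤ dist p (y m) ∧ dist p (y m) < 53 / 50).card)
    {e η : ℝ} (he : -(98309653 / 125000000 : ℝ) ≤ e) (hη : η ≤ 1 / 100) :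
    ∃ (M : ℕ) (z : Fin M → E3), Function.Injective z ∧
      (∀ m : Fin N, R < dist (y m) (y c) → y m ∈ Set.range z) ∧
      (∀ l : Fin M, R < dist (z l) (y c) → z l ∈ Set.range y) ∧
      N ≤ M + ⌈64 * R ^ 3⌉₊ ∧ M ≤ N + ⌈64 * R ^ 3⌉₊ ∧
      interactionEnergy lennardJones z + η ≤ interactionEnergy lennardJones y + e * ((M : ℝ) - N) := by
  have hsep : ∀ i l : Fin 1, i ≠ l → 9 / 10 ≤ dist ((fun _ : Fin 1 => p) i) ((fun _ : Fin 1 => p) l) :=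
    fun i l hil => absurd (Subsingleton.elim i l) hil
  have hqc : ∀ i : Fin 1, dist ((fun _ : Fin 1 => p) i) (y c) ≤ R := fun _ => hpc
  refine improvable_of_creditedVoid hy (k := 1) (q := fun _ : Fin 1 => p) (holes_card_le hR hqc hsep) hqc (fun _ m => hclear m) hsep
    _ (fun t ht => lennardJones_le_neg_wideCredit ht) he ?_
  have hP : ∑ m : Fin N, (3 / 40 : ℝ) * (if 239 / 250 ≤ dist p (y m) ∧ dist p (y m) < 53 / 50 then 1 else 0) =
      3 / 40 * ((Finset.univ.filter fun m : Fin N => 239 / 250 ≤ dist p (y m) ∧ dist p (y m) < 53 / 50).card : ℝ) := by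
    rw [← Finset.mul_sum, Finset.sum_boole]
  have hD : ∑ l ∈ Finset.univ.erase (0 : Fin 1), (3 / 40 : ℝ) * (if 239 / 250 ≤ dist p p ∧ dist p p < 53 / 50 then 1 else 0) = 0 := by
    simp
  simp only [Fin.sum_univ_one] at *
  rw [hP, hD]
  have h11 : (11 : ℝ) ≤ ((Finset.univ.filter fun m : Fin N => 239 / 250 ≤ dist p (y m) ∧ dist p (y m) < 53 / 50).card : ℝ) := by
    exact_mod_cast hcaged
  push_cast
  linarith

/-- **μ-reading of the repaired order-one certificate (PROVED, GS-free):** an `(e, 1/(j+1), j)`-μ-stable injective configuration, `e` a limit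
of `E(N)/N`, `j ≥ max ⌈64R³⌉ 100`, `R ≥ 1`, has at most `10` particles at distance in `[239/250, 53/50)` from any `9/10`-clear point within `R`
of a particle — relaxed vacancies and divacancy sites are absent AT THE CRYSTAL'S SPACING. -/
theorem wideCagedCount_le_of_muStable {e : ℝ} (he : Tendsto (fun N : ℕ => groundStateEnergy lennardJones 3 N / N) atTop (𝓝 e))
    {R : ℝ} (hR : 1 ≤ R) {j : ℕ} (hjR : ⌈64 * R ^ 3⌉₊ ≤ j) (hj : 100 ≤ j) {y : Fin N → E3} (hy : Function.Injective y)
    (hM : ∀ M : ℕ, N ≤ M + j → M ≤ N + j → ∀ z : Fin M → E3, Function.Injective z →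
      interactionEnergy lennardJones y + e * ((M : ℝ) - N) - 1 / ((j : ℝ) + 1) ≤ interactionEnergy lennardJones z)
    (c : Fin N) {p : E3} (hpc : dist p (y c) ≤ R) (hclear : ∀ m : Fin N, 9 / 10 ≤ dist p (y m)) :
    (Finset.univ.filter fun m : Fin N => 239 / 250 ≤ dist p (y m) ∧ dist p (y m) < 53 / 50).card ≤ 10 := by
  by_contra hnot
  have hcaged : 11 ≤ (Finset.univ.filter fun m : Fin N => 239 / 250 ≤ dist p (y m) ∧ dist p (y m) < 53 / 50).card := by omega
  have hεη : 1 / ((j : ℝ) + 1) < 1 / 100 := by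
    have hj' : (100 : ℝ) ≤ j := by exact_mod_cast hj
    rw [div_lt_div_iff₀ (by positivity) (by norm_num)]
    linarith
  exact not_improvable_of_muStable hM hjR hεη c
    (improvable_of_wideCagedHole hy hR hpc hclear hcaged (twoConeB_le_of_tendsto he) le_rfl)

end Summit.AtomisticToContinuum.Crystallization.Theorems.LoopTunnelDialVoidRungCredit
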